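import Summits.Parity.BatemanHorn.Theorems.SoloInformedErdosNairClassIVPrep

/-!
# Erdős's bound `∑_{n ≤ N} τ(|g(n)|) ≪ N log N`: Shiu's class IV at level `r`

Solo informed line (Parity / Bateman–Horn), session 139 — the polynomial analogue of
`Shiu.classIV_r_bound`.  Notation as in `SoloInformedErdosNairClassI`: `m_n = |g(n)| = c_n d_n` cut
at height `z = w²`, cut prime `P_n`.  Class IV at level `r` consists of the `n ≤ N` with `m_n > z`,
`L < P_n ≤ w`, `c_n > w` and `⌊log z / log P_n⌋ = r`; then `r ≥ 2`, `u = z^{1/(r+1)} < P_n ≤ v = z^{1/r}`,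
so `c_n ∈ (w, z]` has all prime factors `< v`, `d_n` has all prime factors `> u`, hence
`τ(d_n) ≤ 2^{(r+1)M₁}` (`log X / log z ≤ M₁`, `m_n ≤ X`), and the fibre `{c_n = c}` lies in the
sifted polynomial progression `{n ≤ N : c ∣ g(n), p ∤ g(n) ∀ p < u, p ∤ c}` counted by
`polySegment_sieve_bound'`; the sieve product `∏_{p<u}(1 − ρ_g(p)/p) ≤ K_up / log u = K_up (r+1)/log z`
is taken as a Mertens-type hypothesis; the weights `h_g(c)/c` over `c > w` are summed by Rankin's
trick with `η = K₁ r / log z ≤ 1/6` (`6K₁ ≤ log L`, `r log L ≤ log z`), saving `w^{−η} = e^{−K₁ r/2}`: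

* `polyClassIV_r_bound` — `∑_{IV, level r} τ(m_n) ≤ 2^{(r+1)M₁} e^{−K₁ r/2} K ((r+1)(N+z)K_up/log z + z^{5/3}) Λ P_g(z)⁻²`,
  `Λ = exp(2W(1+D) e^{K₁}(K₁+1))`, `P_g(z) = ∏_{p ≤ z}(1 − ρ_g(p)/p)`.

Everything is PROVED; no definitions, no named facts.  The summation over `r` is
`SoloInformedErdosNairClassIV`.

References: P. Shiu, J. reine angew. Math. 313 (1980) 161–170, §5 (`∑_{IV}`) and Lemma 3 [Shiu1980];
P. Erdős, J. London Math. Soc. 27 (1952) 7–15 [Erdos1952]; M. Nair, Acta Arith. 62 (1992) 257–269 [Nair1992].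
-/

open Finset Real Polynomial

namespace Summit.Parity.BatemanHorn.Theorems

open Literature.NumberTheory.Sieve

namespace ErdosDivisor

/-- `τ(m) = τ(c_m) τ(d_m) ≤ τ(c_m) 2^M` when `d_m`'s prime factors exceed `u > 1`, `m ≤ X` and
`log X / log u ≤ M`. [folklore] -/
theorem card_divisors_le_mul_two_pow {m c : ℕ} {z u X : ℝ} {M : ℕ} (h0 : m ≠ 0)
    (hcn : Shiu.cPart z m = c) (hu1 : 1 < u) (huP : u < (Shiu.cutPrime z m : ℝ)) (hmX : (m : ℝ) ≤ X)
    (hM : Real.log X / Real.log u ≤ M) : (#m.divisors : ℝ) ≤ #c.divisors * 2 ^ M := by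
  have hsplit : (#m.divisors : ℝ) = #c.divisors * #(Shiu.dPart z m).divisors := by
    conv_lhs => rw [← Shiu.cPart_mul_dPart (z := z) h0]
    rw [Nat.Coprime.card_divisors_mul (Shiu.coprime_cPart_dPart h0), hcn, Nat.cast_mul]
  rw [hsplit]
  refine mul_le_mul_of_nonneg_left ?_ (Nat.cast_nonneg _)
  have hd0 : Shiu.dPart z m ≠ 0 := Shiu.dPart_ne_zero h0
  have hprimes : ∀ p ∈ (Shiu.dPart z m).primeFactors, u ≤ (p : ℝ) := by
    intro p hp
    have h1 := Shiu.cutPrime_le_of_mem_primeFactors_dPart h0 hp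
    have h2 : (Shiu.cutPrime z m : ℝ) ≤ p := by exact_mod_cast h1
    linarith
  have hdX : ((Shiu.dPart z m : ℕ) : ℝ) ≤ X := by
    have h1 : (Shiu.dPart z m : ℝ) ≤ m := by exact_mod_cast Nat.div_le_self m _
    exact h1.trans hmX
  exact card_divisors_le_two_pow_of_rough hd0 hu1 hprimes hdX hM

/-- The fibre `{n ∈ T : c_n = c}` of a set `T ⊆ [1, N]` on which `u < P_n` lies in the sifted
polynomial progression `{n ≤ N : c ∣ g(n), p ∤ g(n) ∀ p < u prime, p ∤ c}`. [folklore] -/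
theorem card_fiber_le_card_sifted (g : ℤ[X]) (N : ℕ) (z u : ℝ) (c : ℕ) (T : Finset ℕ)
    (hT : T ⊆ Icc 1 N) (hT0 : ∀ n ∈ T, (g.eval (n : ℤ)).natAbs ≠ 0)
    (hTu : ∀ n ∈ T, u < (Shiu.cutPrime z (g.eval (n : ℤ)).natAbs : ℝ)) :
    #(T.filter fun n : ℕ => Shiu.cPart z (g.eval (n : ℤ)).natAbs = c) ≤
      #((Icc 1 N).filter fun n : ℕ => (c : ℤ) ∣ g.eval (n : ℤ) ∧
        ∀ p ∈ Nat.primesBelow ⌈u⌉₊, ¬ p ∣ c → ¬ (p : ℤ) ∣ g.eval (n : ℤ)) := by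
  refine card_le_card fun n hn => ?_
  rw [mem_filter] at hn ⊢
  exact ⟨hT hn.1, dvd_and_sifted_of_cPart_eq (hT0 n hn.1) hn.2 (hTu n hn.1)⟩

/-- **Class IV at level `r`** (the polynomial analogue of Shiu 1980, §5, `∑_{IV}`, terms with
`z^{1/(r+1)} < P_n ≤ z^{1/r}`).  Let `ρ_g(p) ≤ D`, `ρ_g(p) < p`, `ρ_g(p^a) ≤ W` (`W ≥ 1`).  There is
`K = K(g) > 0` such that for all `N`, `X`, `w ≥ 2`, `z = w²`, `L ≥ 4`, `K_up ≥ 0`, `K₁ ≥ 0`, `M₁`, `r`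
with `|g(n)| ≤ X` on `[1, N]`, `log X / log z ≤ M₁`, `6K₁ ≤ log L` and
`log u · ∏_{p<u}(1 − ρ_g(p)/p) ≤ K_up` for all `u ≥ 2`:
`∑_{n ≤ N, m_n > z, L < P_n ≤ w, c_n > w, ⌊log z/log P_n⌋ = r} τ(m_n)`
`≤ 2^{(r+1)M₁} e^{−K₁ r/2} K ((r+1)·(N+z)K_up/log z + z^{2/3} z) exp(2W(1+D)e^{K₁}(K₁+1)) (∏_{p ≤ ⌊z⌋}(1 − ρ_g(p)/p))⁻²`.
[cite: Shiu1980, §5 (∑_IV) and Lemma 3]; [this work] -/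
theorem polyClassIV_r_bound {g : ℤ[X]} (hg : HasNoFixedPrimeDivisor ![g]) {D : ℕ} {W : ℝ}
    (hD : ∀ p : ℕ, p.Prime → polyRootCountMod ![g] p ≤ D)
    (hW : ∀ p : ℕ, p.Prime → ∀ a : ℕ, (polyRootCountMod ![g] (p ^ a) : ℝ) ≤ W) (hW1 : 1 ≤ W) :
    ∃ K : ℝ, 0 < K ∧ ∀ (N : ℕ) (X z w L Kup K₁ : ℝ) (M₁ r : ℕ), 2 ≤ w → w * w = z → 4 ≤ L →
      (∀ n ∈ Icc 1 N, (((g.eval (n : ℤ)).natAbs : ℕ) : ℝ) ≤ X) → Real.log X / Real.log z ≤ M₁ →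
      0 ≤ K₁ → 6 * K₁ ≤ Real.log L → 0 ≤ Kup →
      (∀ u : ℝ, 2 ≤ u →
        Real.log u * ∏ p ∈ Nat.primesBelow ⌈u⌉₊, (1 - (polyRootCountMod ![g] p : ℝ) / p) ≤ Kup) →
        ∑ n ∈ (Icc 1 N).filter (fun n : ℕ => z < (((g.eval (n : ℤ)).natAbs : ℕ) : ℝ) ∧
            L < (Shiu.cutPrime z (g.eval (n : ℤ)).natAbs : ℝ) ∧
            (Shiu.cutPrime z (g.eval (n : ℤ)).natAbs : ℝ) ≤ w ∧
            w < (Shiu.cPart z (g.eval (n : ℤ)).natAbs : ℝ) ∧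
            ⌊Real.log z / Real.log (Shiu.cutPrime z (g.eval (n : ℤ)).natAbs)⌋₊ = r),
            (#((g.eval (n : ℤ)).natAbs.divisors) : ℝ) ≤
          2 ^ ((r + 1) * M₁) * Real.exp (-(K₁ * r / 2)) * K *
            (((r : ℝ) + 1) * (((N : ℝ) + z) * Kup / Real.log z) + z ^ (2 / 3 : ℝ) * z) *
            Real.exp (2 * W * (1 + D) * Real.exp K₁ * (K₁ + 1)) *
            ((∏ p ∈ Nat.primesLE ⌊z⌋₊, (1 - (polyRootCountMod ![g] p : ℝ) / p)) ^ 2)⁻¹ := by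
  classical
  obtain ⟨C, hC, hseg⟩ := polySegment_sieve_bound' D
  obtain ⟨K, hK, hR⟩ := exists_weightSum_rankin_le hg hD hW hW1
  refine ⟨C * K, mul_pos hC hK,
    fun N X z w L Kup K₁ M₁ r hw hwz hL hX hM₁ hK₁ hLK hKup hPu => ?_⟩
  -- notation
  set ρ : ℕ → ℝ := fun c => (polyRootCountMod ![g] c : ℝ) with hρ
  set E : ℕ → ℝ := fun c => ∏ p ∈ c.primeFactors, (1 - (polyRootCountMod ![g] p : ℝ) / p)⁻¹ with hE
  set Pz : ℝ := ∏ p ∈ Nat.primesLE ⌊z⌋₊, (1 - (polyRootCountMod ![g] p : ℝ) / p) with hPz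
  set Λ : ℝ := Real.exp (2 * W * (1 + D) * Real.exp K₁ * (K₁ + 1)) with hΛ
  set A : ℝ := ((N : ℝ) + z) * Kup / Real.log z with hA
  set T := (Icc 1 N).filter (fun n : ℕ => z < (((g.eval (n : ℤ)).natAbs : ℕ) : ℝ) ∧
      L < (Shiu.cutPrime z (g.eval (n : ℤ)).natAbs : ℝ) ∧
      (Shiu.cutPrime z (g.eval (n : ℤ)).natAbs : ℝ) ≤ w ∧
      w < (Shiu.cPart z (g.eval (n : ℤ)).natAbs : ℝ) ∧
      ⌊Real.log z / Real.log (Shiu.cutPrime z (g.eval (n : ℤ)).natAbs)⌋₊ = r) with hT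
  have hW0 : 0 ≤ W := zero_le_one.trans hW1
  have hw0 : 0 < w := by linarith
  have hz4 : 4 ≤ z := by nlinarith
  have hz1 : 1 ≤ z := by linarith
  have hz1' : 1 < z := by linarith
  have hz0 : 0 < z := by linarith
  have hlogz : 0 < Real.log z := Real.log_pos hz1'
  have hPz0 : 0 < Pz := prod_primesLE_pos hg z
  have hΛ0 : 0 < Λ := Real.exp_pos _
  have hA0 : 0 ≤ A := div_nonneg (by positivity) hlogz.le
  have hRHS0 : 0 ≤ 2 ^ ((r + 1) * M₁) * Real.exp (-(K₁ * r / 2)) * (C * K) *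
      (((r : ℝ) + 1) * A + z ^ (2 / 3 : ℝ) * z) * Λ * (Pz ^ 2)⁻¹ := by positivity
  -- the empty case
  by_cases hTe : T = ∅
  · rw [hTe, sum_empty]; exact hRHS0
  obtain ⟨n₀, hn₀⟩ := nonempty_iff_ne_empty.2 hTe
  -- facts about `n ∈ T`
  have hTmem : ∀ n ∈ T, n ∈ Icc 1 N ∧ z < (((g.eval (n : ℤ)).natAbs : ℕ) : ℝ) ∧
      L < (Shiu.cutPrime z (g.eval (n : ℤ)).natAbs : ℝ) ∧
      (Shiu.cutPrime z (g.eval (n : ℤ)).natAbs : ℝ) ≤ w ∧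
      w < (Shiu.cPart z (g.eval (n : ℤ)).natAbs : ℝ) ∧
      ⌊Real.log z / Real.log (Shiu.cutPrime z (g.eval (n : ℤ)).natAbs)⌋₊ = r := fun n hn => by
    simpa only [hT, mem_filter, and_assoc] using hn
  have hm2 : ∀ n ∈ T, 2 ≤ (g.eval (n : ℤ)).natAbs := fun n hn =>
    two_le_natAbs_of_lt hz1 (hTmem n hn).2.1
  have hm0 : ∀ n ∈ T, (g.eval (n : ℤ)).natAbs ≠ 0 := fun n hn => by have := hm2 n hn; omega
  -- the level `r`
  have hlev : ∀ n ∈ T, 2 ≤ r ∧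
      (r : ℝ) * Real.log (Shiu.cutPrime z (g.eval (n : ℤ)).natAbs) ≤ Real.log z ∧
      Real.log z < ((r : ℝ) + 1) * Real.log (Shiu.cutPrime z (g.eval (n : ℤ)).natAbs) ∧
      (r : ℝ) * Real.log L ≤ Real.log z := fun n hn => by
    obtain ⟨-, -, hLP, hPw, -, hr⟩ := hTmem n hn
    exact level_facts hw hwz hL hLP hPw hr
  obtain ⟨hr2, -, -, hrL⟩ := hlev n₀ hn₀
  obtain ⟨hu2, huz, hv2, hvz, hη0, hη6, hwη, hvη, hηv, hη4⟩ :=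
    level_params hw hwz hL hK₁ hLK hr2 hrL
  set u : ℝ := z ^ (1 / ((r : ℝ) + 1)) with hu
  set v : ℝ := z ^ (1 / (r : ℝ)) with hv
  set η : ℝ := K₁ * r / Real.log z with hη
  have hu0 : 0 < u := by linarith
  have hu1 : 1 < u := by linarith
  -- the fibre set over `c` and its weight sum (Rankin's trick)
  set Cr := (Icc 1 ⌊z⌋₊).filter (fun c : ℕ =>
    w < (c : ℝ) ∧ ∀ p ∈ c.primeFactors, (p : ℝ) < v) with hCr
  have hsumC : ∑ c ∈ Cr, (#c.divisors : ℝ) * ρ c * E c / c ≤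
      K * Real.exp (-(K₁ * r / 2)) * Λ * (Pz ^ 2)⁻¹ := by
    have h := hR η hη0 hη6 v w hv2 hw0 Cr
      (fun c hc => by have := (mem_Icc.1 (mem_filter.1 hc).1).1; omega)
      (fun c hc => ((mem_filter.1 hc).2.1).le)
      (fun c hc p hp => (mem_filter.1 hc).2.2 p hp)
    refine h.trans ?_
    rw [hwη]
    have hexp : Real.exp (2 * W * (1 + D) * η * v ^ η * (Real.log v + Real.log 4)) ≤ Λ := by
      refine Real.exp_le_exp.2 ?_
      have h1 : 2 * W * (1 + D) * η * v ^ η * (Real.log v + Real.log 4) =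
          2 * W * (1 + D) * Real.exp K₁ * (η * Real.log v + η * Real.log 4) := by
        rw [hvη]; ring
      rw [h1, hηv]
      exact mul_le_mul_of_nonneg_left (by linarith) (by positivity)
    have hPv : ((∏ p ∈ Nat.primesBelow ⌈v⌉₊, (1 - (polyRootCountMod ![g] p : ℝ) / p)) ^ 2)⁻¹ ≤
        (Pz ^ 2)⁻¹ :=
      inv_anti₀ (pow_pos hPz0 2)
        (pow_le_pow_left₀ hPz0.le (prod_primesLE_le_prod_primesBelow hg hvz) 2)
    have hK0 : 0 ≤ K * Real.exp (-(K₁ * r / 2)) := by positivity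
    exact mul_le_mul (mul_le_mul_of_nonneg_left hexp hK0) hPv (by positivity) (by positivity)
  clear hR hwη hvη hηv hη4 hη0 hη6
  -- the window `u < P_n ≤ v`
  have hPuv : ∀ n ∈ T, u < (Shiu.cutPrime z (g.eval (n : ℤ)).natAbs : ℝ) ∧
      (Shiu.cutPrime z (g.eval (n : ℤ)).natAbs : ℝ) ≤ v := fun n hn => by
    obtain ⟨-, -, hLP, -, -, -⟩ := hTmem n hn
    obtain ⟨-, hrP, hPr, -⟩ := hlev n hn
    exact level_window hz1' (by linarith) (by omega) hrP hPr
  -- the sieve product at level `u`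
  have hlogu : Real.log u = Real.log z / (r + 1) := by
    rw [hu, Real.log_rpow hz0]; ring
  set Pu : ℝ := ∏ p ∈ Nat.primesBelow ⌈u⌉₊, (1 - (polyRootCountMod ![g] p : ℝ) / p) with hPudef
  have hPu0 : 0 ≤ Pu := prod_nonneg fun p hp =>
    (one_sub_rho_div_pos hg (Nat.mem_primesBelow.1 hp).2).le
  have hPuK : Pu ≤ ((r : ℝ) + 1) * Kup / Real.log z := by
    have h1 := hPu u hu2
    have hlogu0 : 0 < Real.log u := Real.log_pos hu1
    have h2 : Pu ≤ Kup / Real.log u := by rw [le_div_iff₀ hlogu0, mul_comm]; exact h1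
    have h3 : Kup / Real.log u = ((r : ℝ) + 1) * Kup / Real.log z := by
      rw [hlogu, div_div_eq_mul_div]; ring
    exact h2.trans h3.le
  -- the exponent `(r+1) M₁`
  set Ex := (r + 1) * M₁ with hEx
  have hM' : Real.log X / Real.log u ≤ ((Ex : ℕ) : ℝ) := by
    rw [hlogu, div_div_eq_mul_div, hEx]
    push_cast
    calc Real.log X * ((r : ℝ) + 1) / Real.log z = ((r : ℝ) + 1) * (Real.log X / Real.log z) := by
          ring
      _ ≤ ((r : ℝ) + 1) * M₁ := mul_le_mul_of_nonneg_left hM₁ (by positivity)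
  -- fibres
  have hmaps : ∀ n ∈ T, Shiu.cPart z (g.eval (n : ℤ)).natAbs ∈ Cr := by
    intro n hn
    obtain ⟨-, -, -, -, hcw, -⟩ := hTmem n hn
    rw [hCr, mem_filter, mem_Icc]
    refine ⟨⟨Nat.one_le_iff_ne_zero.2 Shiu.cPart_ne_zero,
      Nat.le_floor (Shiu.cutPrime_mem (hm2 n hn) hz1).2⟩, hcw, fun p hp => ?_⟩
    have h1 := Shiu.lt_of_mem_primeFactors_cPart hp
    exact lt_of_lt_of_le (by exact_mod_cast h1) (hPuv n hn).2
  rw [← sum_fiberwise_of_maps_to hmaps]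
  -- the inner sums
  have hinner : ∀ c ∈ Cr,
      ∑ n ∈ T.filter (fun n : ℕ => Shiu.cPart z (g.eval (n : ℤ)).natAbs = c),
        (#((g.eval (n : ℤ)).natAbs.divisors) : ℝ) ≤
      (#c.divisors : ℝ) * 2 ^ Ex * (C * ρ c * (((N : ℝ) / c + 1) * (Pu * E c) + u ^ 2)) := by
    intro c hc
    have hc1 : 1 ≤ c := (mem_Icc.1 (mem_filter.1 hc).1).1
    have hpt : ∀ n ∈ T.filter (fun n : ℕ => Shiu.cPart z (g.eval (n : ℤ)).natAbs = c),
        (#((g.eval (n : ℤ)).natAbs.divisors) : ℝ) ≤ (#c.divisors : ℝ) * 2 ^ Ex := fun n hn => by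
      obtain ⟨hnT, hcn⟩ := mem_filter.1 hn
      exact card_divisors_le_mul_two_pow (hm0 n hnT) hcn hu1 (hPuv n hnT).1
        (hX n (hTmem n hnT).1) hM'
    have hcardN := card_fiber_le_card_sifted g N z u c T (filter_subset _ _) hm0
      (fun n hn => (hPuv n hn).1)
    have hcard : (#(T.filter (fun n : ℕ => Shiu.cPart z (g.eval (n : ℤ)).natAbs = c)) : ℝ) ≤
        C * ρ c * (((N : ℝ) / c + 1) * (Pu * E c) + u ^ 2) :=
      le_trans (Nat.cast_le.2 hcardN) (hseg g hD hg c hc1 N u hu2)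
    have hτ0 : (0 : ℝ) ≤ (#c.divisors : ℝ) * 2 ^ Ex :=
      mul_nonneg (Nat.cast_nonneg _) (pow_nonneg zero_le_two _)
    calc ∑ n ∈ T.filter (fun n : ℕ => Shiu.cPart z (g.eval (n : ℤ)).natAbs = c),
          (#((g.eval (n : ℤ)).natAbs.divisors) : ℝ)
        ≤ ∑ n ∈ T.filter (fun n : ℕ => Shiu.cPart z (g.eval (n : ℤ)).natAbs = c),
          (#c.divisors : ℝ) * 2 ^ Ex := sum_le_sum hpt
      _ = #(T.filter (fun n : ℕ => Shiu.cPart z (g.eval (n : ℤ)).natAbs = c)) *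
          ((#c.divisors : ℝ) * 2 ^ Ex) := by rw [sum_const, nsmul_eq_mul]
      _ ≤ (C * ρ c * (((N : ℝ) / c + 1) * (Pu * E c) + u ^ 2)) * ((#c.divisors : ℝ) * 2 ^ Ex) :=
          mul_le_mul_of_nonneg_right hcard hτ0
      _ = _ := by ring
  -- per `c`: bring it to the weight `h_g(c)/c`
  have hu23 : u ^ 2 ≤ z ^ (2 / 3 : ℝ) := by
    have h13 : (1 / 3 : ℝ) * ((2 : ℕ) : ℝ) = 2 / 3 := by norm_num
    calc u ^ 2 ≤ (z ^ (1 / 3 : ℝ)) ^ 2 := pow_le_pow_left₀ hu0.le huz 2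
      _ = z ^ (2 / 3 : ℝ) := by rw [← h13, Real.rpow_mul_natCast hz0.le]
  have hcoef : ((N : ℝ) + z) * Pu + u ^ 2 * z ≤ ((r : ℝ) + 1) * A + z ^ (2 / 3 : ℝ) * z := by
    have h1 : ((N : ℝ) + z) * Pu ≤ ((N : ℝ) + z) * (((r : ℝ) + 1) * Kup / Real.log z) :=
      mul_le_mul_of_nonneg_left hPuK (by positivity)
    have h2 : ((N : ℝ) + z) * (((r : ℝ) + 1) * Kup / Real.log z) = ((r : ℝ) + 1) * A := by
      rw [hA]; ring
    have h3 : u ^ 2 * z ≤ z ^ (2 / 3 : ℝ) * z := mul_le_mul_of_nonneg_right hu23 hz0.le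
    linarith
  have hstep : ∀ c ∈ Cr,
      (#c.divisors : ℝ) * 2 ^ Ex * (C * ρ c * (((N : ℝ) / c + 1) * (Pu * E c) + u ^ 2)) ≤
      2 ^ Ex * C * (((r : ℝ) + 1) * A + z ^ (2 / 3 : ℝ) * z) *
        ((#c.divisors : ℝ) * ρ c * E c / c) := by
    intro c hc
    rw [hCr, mem_filter, mem_Icc] at hc
    obtain ⟨⟨hc1, hcz⟩, -, -⟩ := hc
    have hc0' : (0 : ℝ) < c := by exact_mod_cast hc1
    have hcz' : (c : ℝ) ≤ z := (Nat.le_floor_iff hz0.le).1 hcz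
    have hE1 : 1 ≤ E c := one_le_prod_inv_one_sub_rho hg c
    have hρ0 : 0 ≤ ρ c := Nat.cast_nonneg _
    have hτ0 : (0 : ℝ) ≤ #c.divisors := Nat.cast_nonneg _
    have hws := weight_step (N := (N : ℝ)) (P := Pu) (U := u ^ 2) hc0' hcz' hτ0 hρ0 hE1 hPu0
      (by positivity) (Nat.cast_nonneg N)
    have hh0 : 0 ≤ (#c.divisors : ℝ) * ρ c * E c / c :=
      div_nonneg (mul_nonneg (mul_nonneg hτ0 hρ0) (zero_le_one.trans hE1)) hc0'.le
    have h2C : (0 : ℝ) ≤ 2 ^ Ex * C := by positivity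
    calc (#c.divisors : ℝ) * 2 ^ Ex * (C * ρ c * (((N : ℝ) / c + 1) * (Pu * E c) + u ^ 2))
        = 2 ^ Ex * C * ((#c.divisors : ℝ) * (ρ c * (((N : ℝ) / c + 1) * (Pu * E c) + u ^ 2))) := by
          ring
      _ ≤ 2 ^ Ex * C * ((((N : ℝ) + z) * Pu + u ^ 2 * z) * ((#c.divisors : ℝ) * ρ c * E c / c)) :=
          mul_le_mul_of_nonneg_left hws h2C
      _ ≤ 2 ^ Ex * C * ((((r : ℝ) + 1) * A + z ^ (2 / 3 : ℝ) * z) *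
          ((#c.divisors : ℝ) * ρ c * E c / c)) :=
          mul_le_mul_of_nonneg_left (mul_le_mul_of_nonneg_right hcoef hh0) h2C
      _ = _ := by ring
  -- assemble
  have hcoef0 : 0 ≤ 2 ^ Ex * C * (((r : ℝ) + 1) * A + z ^ (2 / 3 : ℝ) * z) := by positivity
  calc ∑ c ∈ Cr, ∑ n ∈ T.filter (fun n : ℕ => Shiu.cPart z (g.eval (n : ℤ)).natAbs = c),
        (#((g.eval (n : ℤ)).natAbs.divisors) : ℝ)
      ≤ ∑ c ∈ Cr, (#c.divisors : ℝ) * 2 ^ Ex * (C * ρ c * (((N : ℝ) / c + 1) * (Pu * E c) + u ^ 2)) :=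
        sum_le_sum hinner
    _ ≤ ∑ c ∈ Cr, 2 ^ Ex * C * (((r : ℝ) + 1) * A + z ^ (2 / 3 : ℝ) * z) *
        ((#c.divisors : ℝ) * ρ c * E c / c) := sum_le_sum hstep
    _ = 2 ^ Ex * C * (((r : ℝ) + 1) * A + z ^ (2 / 3 : ℝ) * z) *
        ∑ c ∈ Cr, (#c.divisors : ℝ) * ρ c * E c / c := by rw [mul_sum]
    _ ≤ 2 ^ Ex * C * (((r : ℝ) + 1) * A + z ^ (2 / 3 : ℝ) * z) *
        (K * Real.exp (-(K₁ * r / 2)) * Λ * (Pz ^ 2)⁻¹) := mul_le_mul_of_nonneg_left hsumC hcoef0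
    _ = 2 ^ Ex * Real.exp (-(K₁ * r / 2)) * (C * K) *
        (((r : ℝ) + 1) * A + z ^ (2 / 3 : ℝ) * z) * Λ * (Pz ^ 2)⁻¹ := by ring

end ErdosDivisor

end Summit.Parity.BatemanHorn.Theorems
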